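import Summits.ResolutionOfSingularities.KangarooAtlas.MizutaniHeatKernel
import HarnessLib

/-!
# The truncated operator `∂σ² + δ ∂u²` (`δ ≠ 0`) on `K[u, σ]/(u^p, σ^p)` and its perturbations: kernel of dimension `≤ 2p − 1`

Cell topic `Summits/ResolutionOfSingularities/KangarooAtlas` (pub-rosobs); namespace
`Summit.ResolutionOfSingularities.KangarooAtlas.Mizutani`.  Part of the Lean transcription of Mizutani 1973 §2
around the in-house note MIZUTANI-PROOF-g59 (AI-written, AI-audited; *AI review is weaker than expert review*; not a
resolution theorem).  The computational core of the «non-degenerate symbol» case of the equality part of Mizutani's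
Lemma 2.9 (p. 94: «`(a² − 4b) = 0`, hence `b = (a/2)²`» — i.e. a non-square symbol is incompatible with
`dim ker D = 2p`): on `B = K[X₀, X₁]/(X₀^p, X₁^p)` with the ordinary degree as weight (`p` odd),

* `waveOp δ = ∂₁ ∘ ∂₁ + δ·∂₀ ∘ ∂₀` (`δ ∈ K`); **`eq_zero_of_waveOp_eq_zero`** — an element of `ker (waveOp δ)`
  (`δ ≠ 0`) whose coefficients at `X₀^i` (`i < p`) and `X₀^i X₁` (`i ≤ p − 2`) vanish is zero (two recursions:
  along the degree-`p` anti-diagonal from `X₀^0 X₁^p = 0`, then upward in the `X₁`-degree);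
* `wavePert r ρ = ∂₁∂₁ + r·∂₀∂₁ + ρ·∂₀∂₀` with `r` of degree `≥ 1` and `ρ ≡ δ`: its leading part is `waveOp δ`, so
  **`finrank_ker_wavePert_le`**: `dim_K ker (wavePert r ρ) ≤ 2p − 1`.

References: [Mizutani1973HironakaGroupSchemes] Lemma 2.9 (2), p. 93–94; folklore.
-/

open MvPolynomial Literature.AlgebraicGeometry.Resolution

namespace Summit.ResolutionOfSingularities.KangarooAtlas.Mizutani

section Wave

variable {K : Type*} [Field K] {p : ℕ} [hp : Fact p.Prime] [CharP K p]

/-- The unit weights (ordinary degree). [folklore] -/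
def unitWeight : Fin 2 → ℕ := fun _ => 1

omit hp [CharP K p] in
/-- All unit weights are `1`. [folklore] -/
@[simp] theorem unitWeight_apply (i : Fin 2) : unitWeight i = 1 := rfl

variable (K p) in
/-- **The truncated wave-type operator** `∂₁ ∘ ∂₁ + δ·∂₀ ∘ ∂₀` on `K[X₀,X₁]/(X^p)`. [folklore] -/
noncomputable def waveOp (δ : K) : BoxQuot (Fin 2) K (p ^ 1) →ₗ[K] BoxQuot (Fin 2) K (p ^ 1) :=
  boxDeriv K 2 (p ^ 1) 1 ∘ₗ boxDeriv K 2 (p ^ 1) 1 +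
    LinearMap.mulLeft K (Ideal.Quotient.mk (boxIdeal (Fin 2) K (p ^ 1)) (C δ)) ∘ₗ
      (boxDeriv K 2 (p ^ 1) 0 ∘ₗ boxDeriv K 2 (p ^ 1) 0)

omit hp [CharP K p] in
/-- `waveOp` unfolded. [folklore] -/
theorem waveOp_apply (δ : K) (z : BoxQuot (Fin 2) K (p ^ 1)) :
    waveOp K p δ z = boxDeriv K 2 (p ^ 1) 1 (boxDeriv K 2 (p ^ 1) 1 z) +
      Ideal.Quotient.mk _ (C δ) * boxDeriv K 2 (p ^ 1) 0 (boxDeriv K 2 (p ^ 1) 0 z) := rfl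

omit hp in
/-- The coefficient relation of `waveOp δ g = 0`. [folklore] -/
theorem coeff_rel_of_waveOp_eq_zero {δ : K} {g : BoxQuot (Fin 2) K (p ^ 1)} (hg : waveOp K p δ g = 0)
    (N : Fin 2 →₀ ℕ) (hN : InBox (p ^ 1) N) :
    coeff (N + Finsupp.single 1 2) (truncQ (Fin 2) K (p ^ 1) g) * ((N 1 + 2) * (N 1 + 1)) +
      δ * (coeff (N + Finsupp.single 0 2) (truncQ (Fin 2) K (p ^ 1) g) * ((N 0 + 2) * (N 0 + 1))) = 0 := by
  have := congrArg (fun z => coeff N (truncQ (Fin 2) K (p ^ 1) z)) hg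
  simp only [waveOp_apply, map_add, map_zero, coeff_add, coeff_zero, truncQ_C_mul, coeff_C_mul] at this
  rw [coeff_truncQ_boxDeriv_boxDeriv 1 g N hN, coeff_truncQ_boxDeriv_boxDeriv 0 g N hN] at this
  exact this

omit hp [CharP K p] in
/-- The box exponent `(i, j)`. [folklore] -/
private theorem inBox_pair {i j : ℕ} (hi : i < p) (hj : j < p) :
    InBox (p ^ 1) (Finsupp.single 0 i + Finsupp.single 1 j : Fin 2 →₀ ℕ) := by
  intro k; fin_cases k
  · show (Finsupp.single 0 i + Finsupp.single 1 j : Fin 2 →₀ ℕ) 0 < p ^ 1; simp [pow_one]; omega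
  · show (Finsupp.single 0 i + Finsupp.single 1 j : Fin 2 →₀ ℕ) 1 < p ^ 1; simp [pow_one]; omega

/-- **Injectivity on `ker (waveOp δ)`** (`δ ≠ 0`, `p ≠ 2`): if `waveOp δ g = 0` and the coefficients of `g` at `X₀^i`
(`i < p`) and at `X₀^i X₁` (`i ≤ p − 2`) vanish, then `g = 0`. [folklore] -/
theorem eq_zero_of_waveOp_eq_zero (hp2 : p ≠ 2) {δ : K} (hδ : δ ≠ 0) {g : BoxQuot (Fin 2) K (p ^ 1)}
    (hg : waveOp K p δ g = 0)
    (h0 : ∀ i : ℕ, i < p → coeff (Finsupp.single 0 i) (truncQ (Fin 2) K (p ^ 1) g) = 0)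
    (h1 : ∀ i : ℕ, i + 1 < p →
      coeff (Finsupp.single 0 i + Finsupp.single 1 1) (truncQ (Fin 2) K (p ^ 1) g) = 0) : g = 0 := by
  have hp1 : p ^ 1 = p := pow_one p
  have hp3 : 3 ≤ p := by have := hp.out.two_le; omega
  set G : ℕ → ℕ → K := fun i j => coeff (Finsupp.single 0 i + Finsupp.single 1 j) (truncQ (Fin 2) K (p ^ 1) g) with hG
  -- the relation at `(i, j)`: `G i (j+2) (j+2)(j+1) + δ G (i+2) j (i+2)(i+1) = 0`
  have hrel : ∀ i j : ℕ, i < p → j < p →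
      G i (j + 2) * (((j : K) + 2) * ((j : K) + 1)) + δ * (G (i + 2) j * (((i : K) + 2) * ((i : K) + 1))) = 0 := by
    intro i j hi hj
    have := coeff_rel_of_waveOp_eq_zero hg _ (inBox_pair hi hj)
    simp only [Finsupp.add_apply, Finsupp.single_eq_same, Finsupp.single_eq_of_ne (show (1 : Fin 2) ≠ 0 by decide),
      Finsupp.single_eq_of_ne (show (0 : Fin 2) ≠ 1 by decide), zero_add, add_zero] at this
    rw [add_assoc, ← Finsupp.single_add, add_right_comm, ← Finsupp.single_add] at this
    exact this
  -- out-of-box coefficients vanish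
  have hout : ∀ i j : ℕ, p ≤ i ∨ p ≤ j → G i j = 0 := by
    intro i j hij
    apply coeff_truncQ_eq_zero_of_not_inBox
    intro hbox
    have h0' := hbox 0
    have h1' := hbox 1
    simp only [Finsupp.add_apply, Finsupp.single_apply, hp1] at h0' h1'
    simp at h0' h1'
    omega
  -- Step A: the even anti-diagonal chain in degree `p`: `G (2k) (p - 2k) = 0`
  have hchain : ∀ k : ℕ, 2 * k ≤ p - 1 → G (2 * k) (p - 2 * k) = 0 := by
    intro k
    induction k with
    | zero => intro _; exact hout 0 _ (Or.inr (by omega))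
    | succ k ih =>
      intro hk
      have hk' : 2 * k ≤ p - 1 := by omega
      have hprev := ih hk'
      -- relation at `(2k, p - 2k - 2)`
      have hr := hrel (2 * k) (p - 2 * k - 2) (by omega) (by omega)
      have heq1 : p - 2 * k - 2 + 2 = p - 2 * k := by omega
      rw [heq1, hprev, zero_mul, zero_add] at hr
      have hne : (((2 * k : ℕ) : K) + 2) * (((2 * k : ℕ) : K) + 1) ≠ 0 := by
        have h2k2 : ((2 * k + 2 : ℕ) : K) ≠ 0 := natCast_ne_zero_of_lt (by omega) (by omega)
        have h2k1 : ((2 * k + 1 : ℕ) : K) ≠ 0 := natCast_ne_zero_of_lt (by omega) (by omega)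
        push_cast at h2k2 h2k1 ⊢
        exact mul_ne_zero h2k2 h2k1
      have h3 := hr
      rw [mul_eq_zero, mul_eq_zero] at h3
      rcases h3 with h3 | h3 | h3
      · exact absurd h3 hδ
      · have : 2 * (k + 1) = 2 * k + 2 := by ring
        rw [this, show p - (2 * k + 2) = p - 2 * k - 2 by omega]
        exact h3
      · exact absurd h3 hne
  have htop : G (p - 1) 1 = 0 := by
    -- `p` is odd: `p - 1 = 2k`
    obtain ⟨k, hk⟩ : ∃ k, p - 1 = 2 * k := by
      have hodd : ¬ 2 ∣ p := by
        intro h2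
        exact hp2 ((Nat.prime_dvd_prime_iff_eq Nat.prime_two hp.out).mp h2).symm
      exact ⟨(p - 1) / 2, by omega⟩
    have := hchain k (by omega)
    rw [← hk, show p - (p - 1) = 1 by omega] at this
    exact this
  -- Step B: all coefficients vanish, by strong induction on the `X₁`-exponent
  have key : ∀ j : ℕ, j < p → ∀ i : ℕ, i < p → G i j = 0 := by
    intro j
    induction j using Nat.strong_induction_on with
    | _ j ih =>
      intro hj i hi
      rcases Nat.lt_or_ge j 2 with hj2 | hj2
      · interval_cases j
        · have := h0 i hi
          simp only [hG, Finsupp.single_zero, add_zero] at this ⊢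
          exact this
        · by_cases hi' : i + 1 < p
          · exact h1 i hi'
          · have : i = p - 1 := by omega
            rw [this]; exact htop
      · -- relation at `(i, j - 2)`
        have hr := hrel i (j - 2) hi (by omega)
        have heq1 : j - 2 + 2 = j := by omega
        rw [heq1] at hr
        have hG2 : G (i + 2) (j - 2) = 0 := by
          by_cases hi2 : i + 2 < p
          · exact ih (j - 2) (by omega) (by omega) (i + 2) hi2
          · exact hout _ _ (Or.inl (by omega))
        rw [hG2, zero_mul, mul_zero, add_zero] at hr
        have hne : (((j - 2 : ℕ) : K) + 2) * (((j - 2 : ℕ) : K) + 1) ≠ 0 := by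
          have hj0 : ((j : ℕ) : K) ≠ 0 := natCast_ne_zero_of_lt (by omega) hj
          have hj1 : ((j - 1 : ℕ) : K) ≠ 0 := natCast_ne_zero_of_lt (by omega) (by omega)
          have e1 : (((j - 2 : ℕ) : K) + 2) = ((j : ℕ) : K) := by
            rw [show j = (j - 2) + 2 from by omega]; push_cast; ring_nf
          have e2 : (((j - 2 : ℕ) : K) + 1) = ((j - 1 : ℕ) : K) := by
            rw [show j - 1 = (j - 2) + 1 from by omega]; push_cast; ring
          rw [e1, e2]
          exact mul_ne_zero hj0 hj1
        rcases mul_eq_zero.mp hr with h3 | h3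
        · exact h3
        · exact absurd h3 hne
  apply eq_zero_of_truncQ_eq_zero
  refine MvPolynomial.ext _ _ fun M => ?_
  rw [coeff_zero]
  by_cases hM : InBox (p ^ 1) M
  · have hM' : M = Finsupp.single 0 (M 0) + Finsupp.single 1 (M 1) := by
      ext k; fin_cases k <;> simp
    rw [hM']
    exact key (M 1) (by have := hM 1; rwa [hp1] at this) (M 0) (by have := hM 0; rwa [hp1] at this)
  · exact coeff_truncQ_eq_zero_of_not_inBox _ hM

/-! ### The partial derivatives commute -/

omit hp [CharP K p] in
/-- Partial derivatives of polynomials commute. [folklore] -/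
theorem pderiv_pderiv_comm {σ : Type*} (i j : σ) (f : MvPolynomial σ K) :
    pderiv i (pderiv j f) = pderiv j (pderiv i f) := by
  classical
  refine MvPolynomial.ext _ _ fun m => ?_
  simp only [coeff_pderiv]
  rw [add_right_comm]
  by_cases hij : i = j
  · subst hij; rfl
  · simp only [Finsupp.add_apply, Finsupp.single_apply, if_neg hij, if_neg (Ne.symm hij), add_zero]
    ring

omit hp in
/-- The partial derivatives of `K[X]/(X^p)` commute. [folklore] -/
theorem boxDeriv_comm (i j : Fin 2) (z : BoxQuot (Fin 2) K (p ^ 1)) :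
    boxDeriv K 2 (p ^ 1) i (boxDeriv K 2 (p ^ 1) j z) = boxDeriv K 2 (p ^ 1) j (boxDeriv K 2 (p ^ 1) i z) := by
  obtain ⟨f, rfl⟩ := Ideal.Quotient.mk_surjective z
  rw [boxDeriv_mk le_rfl, boxDeriv_mk le_rfl, boxDeriv_mk le_rfl, boxDeriv_mk le_rfl, pderiv_pderiv_comm]

/-! ### Weight properties -/

omit hp in
/-- `waveOp` lowers degrees by `2`. [folklore] -/
theorem waveOp_mem_wdegIdeal (δ : K) {m : ℕ} {z : BoxQuot (Fin 2) K (p ^ 1)}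
    (hz : z ∈ wdegIdeal K 2 (p ^ 1) unitWeight m) : waveOp K p δ z ∈ wdegIdeal K 2 (p ^ 1) unitWeight (m - 2) := by
  rw [waveOp_apply]
  refine Submodule.add_mem _ ?_ (Ideal.mul_mem_left _ _ ?_)
  · have h1 := boxDeriv_mem_wdegIdeal unitWeight le_rfl 1 (boxDeriv_mem_wdegIdeal unitWeight le_rfl 1 hz)
    simp only [unitWeight_apply] at h1
    exact wdegIdeal_anti unitWeight (by omega) h1
  · have h0 := boxDeriv_mem_wdegIdeal unitWeight le_rfl 0 (boxDeriv_mem_wdegIdeal unitWeight le_rfl 0 hz)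
    simp only [unitWeight_apply] at h0
    exact wdegIdeal_anti unitWeight (by omega) h0

omit hp in
/-- `waveOp` maps degree-`m` homogeneous classes to degree-`(m−2)` ones. [folklore] -/
theorem waveOp_mem_whomog (δ : K) {m : ℕ} {z : BoxQuot (Fin 2) K (p ^ 1)}
    (hz : z ∈ whomog K 2 (p ^ 1) unitWeight m) (hm : 2 ≤ m) : waveOp K p δ z ∈ whomog K 2 (p ^ 1) unitWeight (m - 2) := by
  rw [waveOp_apply]
  have heq : m - 1 - 1 = m - 2 := by omega
  refine Submodule.add_mem _ ?_ (C_mul_mem_whomog unitWeight ?_ δ)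
  · have h1 := boxDeriv_mem_whomog unitWeight le_rfl 1 (boxDeriv_mem_whomog unitWeight le_rfl 1 hz)
    simp only [unitWeight_apply] at h1
    rwa [heq] at h1
  · have h0 := boxDeriv_mem_whomog unitWeight le_rfl 0 (boxDeriv_mem_whomog unitWeight le_rfl 0 hz)
    simp only [unitWeight_apply] at h0
    rwa [heq] at h0

omit hp in
/-- `waveOp` kills homogeneous classes of degree `< 2`. [folklore] -/
theorem waveOp_eq_zero_of_lt (δ : K) {m : ℕ} {z : BoxQuot (Fin 2) K (p ^ 1)}
    (hz : z ∈ whomog K 2 (p ^ 1) unitWeight m) (hm : m < 2) : waveOp K p δ z = 0 := by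
  have hdd : ∀ i : Fin 2, boxDeriv K 2 (p ^ 1) i (boxDeriv K 2 (p ^ 1) i z) = 0 := by
    intro i
    rcases Nat.lt_or_ge m 1 with h0 | h1
    · rw [boxDeriv_eq_zero_of_mem_whomog unitWeight le_rfl i hz (by simp; omega), map_zero]
    · have h1' := boxDeriv_mem_whomog unitWeight le_rfl i hz
      simp only [unitWeight_apply] at h1'
      exact boxDeriv_eq_zero_of_mem_whomog unitWeight le_rfl i h1' (by simp; omega)
  rw [waveOp_apply, hdd 1, hdd 0, mul_zero, add_zero]

/-! ### The perturbed operator -/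

variable (K p) in
/-- **The perturbed wave operator** `∂₁∂₁ + r·∂₀∂₁ + ρ·∂₀∂₀`. [folklore] -/
noncomputable def wavePert (r ρ : BoxQuot (Fin 2) K (p ^ 1)) : BoxQuot (Fin 2) K (p ^ 1) →ₗ[K] BoxQuot (Fin 2) K (p ^ 1) :=
  boxDeriv K 2 (p ^ 1) 1 ∘ₗ boxDeriv K 2 (p ^ 1) 1 +
    LinearMap.mulLeft K r ∘ₗ (boxDeriv K 2 (p ^ 1) 0 ∘ₗ boxDeriv K 2 (p ^ 1) 1) +
    LinearMap.mulLeft K ρ ∘ₗ (boxDeriv K 2 (p ^ 1) 0 ∘ₗ boxDeriv K 2 (p ^ 1) 0)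

omit hp [CharP K p] in
/-- `wavePert` unfolded. [folklore] -/
theorem wavePert_apply (r ρ z : BoxQuot (Fin 2) K (p ^ 1)) :
    wavePert K p r ρ z = boxDeriv K 2 (p ^ 1) 1 (boxDeriv K 2 (p ^ 1) 1 z) +
      r * boxDeriv K 2 (p ^ 1) 0 (boxDeriv K 2 (p ^ 1) 1 z) + ρ * boxDeriv K 2 (p ^ 1) 0 (boxDeriv K 2 (p ^ 1) 0 z) := rfl

omit hp in
/-- **The perturbation raises degrees**: with `r` of degree `≥ 1` and `ρ − δ` of degree `≥ 1`,
`(wavePert r ρ − waveOp δ)` maps `wdegIdeal m` into `wdegIdeal (m − 2 + 1)`. [folklore] -/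
theorem wavePert_sub_waveOp_mem {r ρ : BoxQuot (Fin 2) K (p ^ 1)} {δ : K}
    (hr : r ∈ wdegIdeal K 2 (p ^ 1) unitWeight 1) (hρ : ρ - Ideal.Quotient.mk _ (C δ) ∈ wdegIdeal K 2 (p ^ 1) unitWeight 1)
    (m : ℕ) (z : BoxQuot (Fin 2) K (p ^ 1)) (hz : z ∈ wdegIdeal K 2 (p ^ 1) unitWeight m) :
    (wavePert K p r ρ - waveOp K p δ) z ∈ wdegIdeal K 2 (p ^ 1) unitWeight (m - 2 + 1) := by
  set d0 := boxDeriv K 2 (p ^ 1) 0 with hd0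
  set d1 := boxDeriv K 2 (p ^ 1) 1 with hd1
  have hexp : (wavePert K p r ρ - waveOp K p δ) z =
      r * d0 (d1 z) + (ρ - Ideal.Quotient.mk _ (C δ)) * d0 (d0 z) := by
    rw [LinearMap.sub_apply, wavePert_apply, waveOp_apply]
    ring
  rw [hexp]
  have hd : ∀ (i : Fin 2) (k : ℕ) (y : BoxQuot (Fin 2) K (p ^ 1)), y ∈ wdegIdeal K 2 (p ^ 1) unitWeight k →
      boxDeriv K 2 (p ^ 1) i y ∈ wdegIdeal K 2 (p ^ 1) unitWeight (k - 1) :=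
    fun i k y hy => by simpa using boxDeriv_mem_wdegIdeal unitWeight le_rfl i hy
  refine Submodule.add_mem _ ?_ ?_
  · have h1 := mul_mem_wdegIdeal unitWeight hr (hd 0 _ _ (hd 1 m z hz))
    exact wdegIdeal_anti unitWeight (by omega) h1
  · have h1 := mul_mem_wdegIdeal unitWeight hρ (hd 0 _ _ (hd 0 m z hz))
    exact wdegIdeal_anti unitWeight (by omega) h1

/-- The index set: `X₀^i` (`i < p`) and `X₀^i X₁` (`i < p − 1`). [folklore] -/
noncomputable def waveIdx (p : ℕ) : Finset (Fin 2 →₀ ℕ) :=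
  (Finset.univ.image fun i : Fin p => (Finsupp.single 0 (i : ℕ) : Fin 2 →₀ ℕ)) ∪
    (Finset.univ.image fun i : Fin (p - 1) => (Finsupp.single 0 (i : ℕ) + Finsupp.single 1 1 : Fin 2 →₀ ℕ))

omit hp [CharP K p] in
/-- It has `2p − 1` elements. [folklore] -/
theorem card_waveIdx (hp1 : 1 ≤ p) : (waveIdx p).card = 2 * p - 1 := by
  unfold waveIdx
  rw [Finset.card_union_of_disjoint, Finset.card_image_of_injective, Finset.card_image_of_injective, Finset.card_univ,
    Finset.card_univ, Fintype.card_fin, Fintype.card_fin]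
  · omega
  · intro i i' h
    have := congrArg (fun M : Fin 2 →₀ ℕ => M 0) h
    simp only [Finsupp.add_apply, Finsupp.single_apply] at this
    simp at this
    exact Fin.ext this
  · intro i i' h
    have := congrArg (fun M : Fin 2 →₀ ℕ => M 0) h
    simp at this
    exact Fin.ext this
  · rw [Finset.disjoint_left]
    intro M hM hM'
    obtain ⟨i, -, rfl⟩ := Finset.mem_image.mp hM
    obtain ⟨i', -, hi'⟩ := Finset.mem_image.mp hM'
    have := congrArg (fun M : Fin 2 →₀ ℕ => M 1) hi'
    simp at this

/-- **`dim_K ker (wavePert r ρ) ≤ 2p − 1`** for `r` of degree `≥ 1` and `ρ ≡ δ ≠ 0` modulo degree `≥ 1` (`p ≠ 2`).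
[cite: Mizutani1973HironakaGroupSchemes, Lemma 2.9 (2) (proof outline, p. 94: «(a² − 4b) = 0»)] -/
theorem finrank_ker_wavePert_le (hp2 : p ≠ 2) {r ρ : BoxQuot (Fin 2) K (p ^ 1)} {δ : K} (hδ : δ ≠ 0)
    (hr : r ∈ wdegIdeal K 2 (p ^ 1) unitWeight 1) (hρ : ρ - Ideal.Quotient.mk _ (C δ) ∈ wdegIdeal K 2 (p ^ 1) unitWeight 1) :
    Module.finrank K (LinearMap.ker (wavePert K p r ρ)) ≤ 2 * p - 1 := by
  have key := finrank_ker_le_card_of_initialForm unitWeight (Ψ := wavePert K p r ρ) (Q₀ := waveOp K p δ) (d := 2)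
    (fun m z hz hm => waveOp_mem_whomog δ hz hm) (fun m z hz hm => waveOp_eq_zero_of_lt δ hz hm)
    (fun m z hz => waveOp_mem_wdegIdeal δ hz) (wavePert_sub_waveOp_mem hr hρ) (waveIdx p)
    (fun g hg hcoef => eq_zero_of_waveOp_eq_zero hp2 hδ hg
      (fun i hi => hcoef _ (Finset.mem_union_left _ (Finset.mem_image.mpr ⟨⟨i, hi⟩, Finset.mem_univ _, rfl⟩)))
      (fun i hi => hcoef _ (Finset.mem_union_right _
        (Finset.mem_image.mpr ⟨⟨i, by omega⟩, Finset.mem_univ _, rfl⟩))))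
  rwa [card_waveIdx hp.out.one_lt.le] at key

end Wave

end Summit.ResolutionOfSingularities.KangarooAtlas.Mizutani
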